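import Literature.AlgebraicGeometry.AbelianVarieties.HomogeneousLineBundleFieldChange
import Literature.AlgebraicGeometry.AbelianVarieties.LineBundleTensorPower
import Literature.AlgebraicGeometry.Modules.UnitCocyclePresented
import HarnessLib

/-!
# Homogeneous line bundles pull back additively: `(f·g)^*L ≅ f^*L ⊗ g^*L` and `[n]^*L ≅ L^{⊗n}` on `Pic⁰`
# ([MumfordAV1970] §8 (ii)–(iii), over an algebraically closed field)

Layer `Literature/AlgebraicGeometry/AbelianVarieties`, namespace `Literature.AlgebraicGeometry.AbelianVarieties`.
Cell `hodgecm-mathlib`, HECKE-LINK brick H2 file (ii), input of (SYM-n) «the dual of `[n]_A` is `[n]_Â`» (D6 (u2)); the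
field half.  THEOREMS ONLY (no definition, no named fact, no instance, no `sorry`).

For an abelian variety `B` over an algebraically closed field `K` and a homogeneous rank-one module `L` on `B` (the tree's
`IsHomogeneous`: `t_P^*L ≅ L` for all rational points `P`, i.e. `L ∈ Pic⁰`; [MumfordAV1970] §8 (i)):

* §1 `cechPic_pullback_mul_detClass` — **`m^*[L] = p₁^*[L]·p₂^*[L]`** in `Ȟ¹(B × B, 𝒪^×)` ([MumfordAV1970] §8 (ii)): `L ≅ 𝒪(Θ)`
  with `K(Θ) = B(K)` and Mumford's class `[Λ(𝒪(Θ))] = m^*[Θ]·(p₁^*[Θ])⁻¹·(p₂^*[Θ])⁻¹` vanishes (★ seesaw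
  `mk_mumfordCocycle_eq_one_of_forall_linEquiv`);
* §2 `cechPic_pullback_hom_mul_detClass` — **`(f·g)^*[L] = f^*[L]·g^*[L]`** for any two `K`-morphisms `f, g : Y → B`
  ([MumfordAV1970] §8 (iii): pull §1 back along `(f, g)`); `cechPic_pullback_pow_id_detClass` — **`[n]^*[L] = [L]ⁿ`**;
* §3 module forms: `nonempty_pullback_hom_mul_iso_tensorObj` (`(f·g)^*L ≅ f^*L ⊗ g^*L`) and
  **`nonempty_pullback_pow_id_iso_tensorPow`** (`[n]^*L ≅ L^{⊗n}`, [MumfordAV1970] §8 (iv)), through `Pic ↪ Ȟ¹(-, 𝒪^×)`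
  (★ `nonempty_iso_iff_detClass_eq`).

HC_CM is proved only modulo the 7 printed citations until rung 0 closes; nothing here is about HC.

## References
* [MumfordAV1970] D. Mumford, *Abelian Varieties* (1970), §8 pp. 74–75 ((i)–(iv) for `Pic⁰`; `(f+g)^*L ≅ f^*L ⊗ g^*L`,
  `n_X^*L ≅ Lⁿ`), §5 Cor. 6 (seesaw).
* [Hartshorne1977] R. Hartshorne, *Algebraic Geometry* (1977), II Ex. 6.11 and III Ex. 4.5 (`Pic` and `Ȟ¹(X, 𝒪^×)`).
-/

noncomputable section

open CategoryTheory CategoryTheory.Limits AlgebraicGeometry MonoidalCategory CartesianMonoidalCategory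
open scoped MonObj

universe u

-- `Scheme.Modules` / `SheafOfModules` are not reducible (as in Mathlib's `AlgebraicGeometry/Modules/Sheaf.lean`).
set_option backward.isDefEq.respectTransparency false

namespace Literature.AlgebraicGeometry.AbelianVarieties

open Literature.AlgebraicGeometry.Motives Literature.AlgebraicGeometry.Modules

variable {K : Type u} [Field K] [IsAlgClosed K] (B : AbelianVariety K) {L : B.X.left.Modules}

/-! ## §1 `m^*[L] = p₁^*[L]·p₂^*[L]` for `L ∈ Pic⁰` -/

/-- **[MumfordAV1970] §8 (ii) for the tree's `IsHomogeneous`**: for a homogeneous rank-one module `L` on an abelian variety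
over an algebraically closed field, `m^*[L] = p₁^*[L]·p₂^*[L]` in `Ȟ¹(B × B, 𝒪^×)` (`m = p₁·p₂` the group law, as the product of
the projections in the group of `B × B`-valued points).  Proof: `L ≅ 𝒪(Θ)` (★ `exists_iso_lineBundle_toUnitCocycle`) with
`t_P^*Θ ∼ Θ` for all `P` (★ `isHomogeneous_lineBundle_iff_forall_linEquiv`), so Mumford's class `[Λ(𝒪(Θ))]` is trivial (★
`mk_mumfordCocycle_eq_one_of_forall_linEquiv`, seesaw). [cite: MumfordAV1970, §8 ((i) ⇔ (ii), pp. 74–75)] -/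
theorem cechPic_pullback_mul_detClass (h₁ : HasRank L 1) (hL : IsFiniteLocallyFree L) (h : IsHomogeneous B L) :
    CechPic.pullback (fst B.X B.X * snd B.X B.X).left (detClass hL) =
      CechPic.pullback (fst B.X B.X).left (detClass hL) * CechPic.pullback (snd B.X B.X).left (detClass hL) := by
  obtain ⟨Θ, ⟨φ⟩⟩ := exists_iso_lineBundle_toUnitCocycle h₁
  have hΘ : ∀ P : B.Points K, (Θ.pullback (B.translation P).left).LinEquiv Θ :=
    (isHomogeneous_lineBundle_iff_forall_linEquiv B Θ).1 ((isHomogeneous_iff_of_iso B φ).1 h)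
  have hc : detClass hL = Θ.cechClass := detClass_eq_cechClass_of_iso φ hL
  have key := mk_mumfordCocycle_eq_one_of_forall_linEquiv B Θ hΘ
  rw [mk_mumfordCocycle, mul_inv_eq_one] at key
  rw [hc, key]

/-! ## §2 `(f·g)^*[L] = f^*[L]·g^*[L]` and `[n]^*[L] = [L]ⁿ` -/

/-- **[MumfordAV1970] §8 (iii)**: for `L ∈ Pic⁰(B)` and any two `K`-morphisms `f, g : Y → B`, `(f·g)^*[L] = f^*[L]·g^*[L]`
(`f·g = (f, g) ≫ m`, and §1 pulled back along `(f, g)`). [cite: MumfordAV1970, §8 ((iii), p. 75)] -/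
theorem cechPic_pullback_hom_mul_detClass (h₁ : HasRank L 1) (hL : IsFiniteLocallyFree L) (h : IsHomogeneous B L)
    {Y : SchemeOver K} (f g : Y ⟶ B.X) :
    CechPic.pullback (f * g).left (detClass hL) =
      CechPic.pullback f.left (detClass hL) * CechPic.pullback g.left (detClass hL) := by
  have hfg : f * g = lift f g ≫ (fst B.X B.X * snd B.X B.X) := by rw [MonObj.comp_mul, lift_fst, lift_snd]
  have hf : (lift f g).left ≫ (fst B.X B.X).left = f.left := by rw [← Over.comp_left, lift_fst]
  have hg : (lift f g).left ≫ (snd B.X B.X).left = g.left := by rw [← Over.comp_left, lift_snd]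
  rw [hfg, Over.comp_left, CechPic.pullback_comp, cechPic_pullback_mul_detClass B h₁ hL h, map_mul,
    ← CechPic.pullback_comp, ← CechPic.pullback_comp, hf, hg]

/-- **`[n]^*[L] = [L]ⁿ` for `L ∈ Pic⁰(B)`** (`[n] = 𝟙ⁿ` in the group of `B`-valued points; §2 by induction).
[cite: MumfordAV1970, §8 ((iv), p. 75)] -/
theorem cechPic_pullback_pow_id_detClass (h₁ : HasRank L 1) (hL : IsFiniteLocallyFree L) (h : IsHomogeneous B L) :
    ∀ n : ℕ, CechPic.pullback ((𝟙 B.X) ^ n).left (detClass hL) = detClass hL ^ n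
  | 0 => by
    -- `𝟙⁰ = 1` and `1·1 = 1`: `a := 1^*[L]` satisfies `a = a·a` by §2, so `a = 1`
    rw [pow_zero, pow_zero]
    have key := cechPic_pullback_hom_mul_detClass B h₁ hL h (1 : B.X ⟶ B.X) 1
    rw [mul_one] at key
    exact (mul_eq_left.1 key.symm)
  | n + 1 => by
    rw [pow_succ, pow_succ, cechPic_pullback_hom_mul_detClass B h₁ hL h, cechPic_pullback_pow_id_detClass h₁ hL h n,
      Over.id_left, CechPic.pullback_id]

/-! ## §3 Module forms -/

/-- **`(f·g)^*L ≅ f^*L ⊗ g^*L` for `L ∈ Pic⁰(B)`** and `K`-morphisms `f, g : Y → B` ([MumfordAV1970] §8 (iii), module form via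
`Pic(Y) ↪ Ȟ¹(Y, 𝒪^×)`, ★ `nonempty_iso_iff_detClass_eq`). [cite: MumfordAV1970, §8 ((iii), p. 75)] -/
theorem nonempty_pullback_hom_mul_iso_tensorObj (h₁ : HasRank L 1) (hL : IsFiniteLocallyFree L) (h : IsHomogeneous B L)
    {Y : SchemeOver K} (f g : Y ⟶ B.X) :
    Nonempty ((Scheme.Modules.pullback (f * g).left).obj L ≅
      tensorObj ((Scheme.Modules.pullback f.left).obj L) ((Scheme.Modules.pullback g.left).obj L)) := by
  rw [nonempty_iso_iff_detClass_eq (hasRank_pullback _ h₁)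
    (hasRank_tensorObj_one (hasRank_pullback _ h₁) (hasRank_pullback _ h₁)) (hL.pullback _)
    (isFiniteLocallyFree_tensorObj _ _ (hL.pullback _) (hL.pullback _)),
    detClass_tensorObj_of_hasRank_one (hasRank_pullback _ h₁) (hasRank_pullback _ h₁) (hL.pullback _) (hL.pullback _),
    detClass_pullback, detClass_pullback, detClass_pullback]
  exact cechPic_pullback_hom_mul_detClass B h₁ hL h f g

/-- **`[n]^*L ≅ L^{⊗n}` for `L ∈ Pic⁰(B)`** ([MumfordAV1970] §8 (iv) «`n_X^*L ≅ Lⁿ`», module form).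
[cite: MumfordAV1970, §8 ((iv), p. 75)] -/
theorem nonempty_pullback_pow_id_iso_tensorPow (h₁ : HasRank L 1) (hL : IsFiniteLocallyFree L) (h : IsHomogeneous B L)
    (n : ℕ) :
    Nonempty ((Scheme.Modules.pullback ((𝟙 B.X) ^ n).left).obj L ≅ tensorPow L n) := by
  rw [nonempty_iso_iff_detClass_eq (hasRank_pullback _ h₁) (hasRank_tensorPow_one h₁ n) (hL.pullback _)
    (isFiniteLocallyFree_tensorPow hL n), detClass_tensorPow h₁ hL n, detClass_pullback]
  exact cechPic_pullback_pow_id_detClass B h₁ hL h n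

end Literature.AlgebraicGeometry.AbelianVarieties

end
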